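import Summits.AtomisticToContinuum.BoseEinsteinCondensation.Theorems.InsertionFieldDelocalisation.Negative.Toolkit
import Summits.AtomisticToContinuum.BoseEinsteinCondensation.Theorems.InsertionFieldDelocalisation.Negative.Tightness
import Summits.AtomisticToContinuum.BoseEinsteinCondensation.Theorems.InsertionFieldDelocalisation.Negative.PerronExistence
import Summits.AtomisticToContinuum.BoseEinsteinCondensation.Theorems.BECStronglyRayleighSectorGroundStatePerron
import Literature.MathematicalPhysics.QuantumLattice.LiebMattisSectorPF
import HarnessLib

/-!
# Line `log-insertion-infrared-bound` reduced to its single bet — kernel-checked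
(crux `BECStronglyRayleigh.InsertionFieldDelocalisation`, stmt-AtomisticToContinuum-9673;
refuter evidence from the drefute seat refuter-drefute-stmt-AtomisticToContinuum-9673-0, 2026-08-16).

Sorry-free proofs of the three "provable now" stubs of `Lines/log-insertion-infrared-bound.lean`
(statements verbatim): S1 `stub_thirdMomentReduction_proof`, S2 `stub_amplitudePos_proof`,
S3 `stub_logMeanDomination_proof`, and the composition
`insertionFieldDelocalisation_of_logInsertionExpMoment : (∃ K, LogInsertionExpMoment K) → crux`.
So the crux now provably follows from S4 `stub_logInsertionExpMoment` ALONE (constant `M = 8K`).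
These are positive results: NOT landed by the refuter; attached as candidate proofs for the lead /
stub-workers to file under `Theorems/` (split per stub as they see fit).
-/

noncomputable section

open scoped BigOperators
open Literature.MathematicalPhysics.QuantumLattice Literature.Probability.LatticeModels
open Summit.AtomisticToContinuum.BoseEinsteinCondensation.Theorems.InsertionFieldDelocalisation.Negative
open Summit.AtomisticToContinuum.BoseEinsteinCondensation.Theorems.BECStronglyRayleighSectorPerron

namespace Summit.AtomisticToContinuum.BoseEinsteinCondensation.Cruxes.InsertionFieldDelocalisation.LogInsertionInfraredBound.Drefute

/-! ### S1 · third-moment reduction -/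


/-- **Deterministic third-moment bound for the crux functional.** For `r ≥ 0` vanishing off `s`
(`n = #s`) and `0 ≤ V ≤ 2n`: `V · K1lhs r ≤ 4 · K1rhs r · A₃`, `A₃ = n⁻¹ Σ_{x∈s} (n r_x / Σ r)³`
(both sides `0` when `r ≡ 0`). [folklore] -/
theorem mul_K1lhs_le_four_mul_thirdMoment {ι : Type*} [Fintype ι] (r : ι → ℝ) (hr : ∀ i, 0 ≤ r i)
    (s : Finset ι) (hs : ∀ i, i ∉ s → r i = 0) (V : ℝ) (hV0 : 0 ≤ V) (hV : V ≤ 2 * (s.card : ℝ)) :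
    V * K1lhs r ≤
      4 * (K1rhs r * ((∑ x ∈ s, ((s.card : ℝ) * r x / ∑ y, r y) ^ 3) / (s.card : ℝ))) := by
  -- sums over `univ` are sums over the support `s`
  have hsum : ∀ k : ℕ, k ≠ 0 → ∑ x, r x ^ k = ∑ x ∈ s, r x ^ k := fun k hk => by
    symm
    exact Finset.sum_subset (Finset.subset_univ s) fun x _ hx => by rw [hs x hx, zero_pow hk]
  have hsum1 : ∑ x, r x = ∑ x ∈ s, r x := by
    have h := hsum 1 one_ne_zero
    simpa using h
  set R := ∑ y, r y with hRdef
  set P2 := ∑ x, r x ^ 2 with hP2def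
  set P3 := ∑ x, r x ^ 3 with hP3def
  have hRnn : 0 ≤ R := Finset.sum_nonneg fun i _ => hr i
  have hP2nn : 0 ≤ P2 := Finset.sum_nonneg fun i _ => by positivity
  have hP3nn : 0 ≤ P3 := Finset.sum_nonneg fun i _ => pow_nonneg (hr i) 3
  by_cases hR0 : R = 0
  · -- then `r ≡ 0` and both sides vanish
    have h0 : ∀ i, r i = 0 := fun i =>
      (Finset.sum_eq_zero_iff_of_nonneg fun j _ => hr j).mp (hRdef ▸ hR0 : ∑ y, r y = 0) i
        (Finset.mem_univ i)
    have hl : K1lhs r = 0 := by simp [K1lhs, h0]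
    have hr' : K1rhs r = 0 := by simp [K1rhs, h0]
    rw [hl, hr']
    simp
  have hRpos : 0 < R := lt_of_le_of_ne hRnn (Ne.symm hR0)
  -- the support is nonempty, `n > 0`
  have hsne : s.Nonempty := by
    have : ∑ x ∈ s, r x ≠ 0 := by rwa [← hsum1]
    obtain ⟨a, ha, _⟩ := Finset.exists_ne_zero_of_sum_ne_zero this
    exact ⟨a, ha⟩
  have hn : (0 : ℝ) < s.card := by exact_mod_cast hsne.card_pos
  -- Step 1: `K1lhs r ≤ 2 P3 / R`
  have hK : K1lhs r ≤ 2 * P3 / R := by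
    have hcs := sq_sum_sq_le_sum_mul_sum_cube r hr
    rw [← hP2def, ← hRdef, ← hP3def] at hcs
    have t : P2 ^ 2 / R ^ 2 ≤ P3 / R := by
      rw [div_le_div_iff₀ (by positivity) hRpos]
      calc P2 ^ 2 * R ≤ R * P3 * R := mul_le_mul_of_nonneg_right hcs hRnn
        _ = P3 * R ^ 2 := by ring
    calc K1lhs r = P3 / R + P2 ^ 2 / R ^ 2 := rfl
      _ ≤ P3 / R + P3 / R := by linarith
      _ = 2 * P3 / R := by ring
  -- Step 2: Cauchy–Schwarz on the support: `R² ≤ n P2`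
  have hCS : R ^ 2 ≤ (s.card : ℝ) * P2 := by
    rw [hsum1, hP2def, hsum 2 two_ne_zero]
    exact sq_sum_le_card_mul_sum_sq
  -- Step 3: the third-moment expression equals `n² P3 / R³`
  have hA : (∑ x ∈ s, ((s.card : ℝ) * r x / ∑ y, r y) ^ 3) / (s.card : ℝ) =
      (s.card : ℝ) ^ 2 * P3 / R ^ 3 := by
    rw [hP3def, hsum 3 three_ne_zero, ← hRdef]
    have e : ∑ x ∈ s, ((s.card : ℝ) * r x / R) ^ 3 = (s.card : ℝ) ^ 3 / R ^ 3 * ∑ x ∈ s, r x ^ 3 := by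
      rw [Finset.mul_sum]
      refine Finset.sum_congr rfl fun x _ => ?_
      rw [div_pow, mul_pow]
      ring
    rw [e]
    field_simp
  rw [hA, show K1rhs r = P2 from rfl]
  -- Step 4: assemble
  have hVR : V * R ^ 2 ≤ 2 * (s.card : ℝ) ^ 2 * P2 :=
    calc V * R ^ 2 ≤ 2 * (s.card : ℝ) * R ^ 2 := mul_le_mul_of_nonneg_right hV (sq_nonneg R)
      _ ≤ 2 * (s.card : ℝ) * ((s.card : ℝ) * P2) := mul_le_mul_of_nonneg_left hCS (by positivity)
      _ = 2 * (s.card : ℝ) ^ 2 * P2 := by ring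
  calc V * K1lhs r ≤ V * (2 * P3 / R) := mul_le_mul_of_nonneg_left hK hV0
    _ = 2 * P3 * (V * R ^ 2) / R ^ 3 := by field_simp
    _ ≤ 2 * P3 * (2 * (s.card : ℝ) ^ 2 * P2) / R ^ 3 :=
        div_le_div_of_nonneg_right (mul_le_mul_of_nonneg_left hVR (by positivity)) (by positivity)
    _ = 4 * (P2 * ((s.card : ℝ) ^ 2 * P3 / R ^ 3)) := by
        field_simp
        ring

/-- **Stub S1 `stub_thirdMomentReduction`** (statement verbatim from the skeleton
`Lines/log-insertion-infrared-bound.lean`): the `ω`-averaged normalised third moment controls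
the crux functional with constant `8K` (indeed `4K`). [folklore] -/
theorem stub_thirdMomentReduction_proof :
    ∀ K : ℝ,
      (∀ (L : ℕ) [NeZero L], 2 ≤ L → ∀ N : ℕ, 2 ≤ N → 2 * N ≤ L ^ 3 →
        ∀ ψ : TensorIndex (TorusSite 3 L) 2 → ℂ,
          ψ ∈ spinZSector 1 ((N : ℝ) - (L : ℝ) ^ 3 / 2) → ψ ≠ 0 →
          (xyTorus 3 L 1).mulVec ψ =
            ((lowestEnergyInSector 1 (xyTorus 3 L 1) ((N : ℝ) - (L : ℝ) ^ 3 / 2) : ℝ) : ℂ) • ψ →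
          (∀ σ, 0 ≤ (ψ σ).re ∧ (ψ σ).im = 0) →
          ∑ T ∈ (Finset.univ : Finset (TorusSite 3 L)).powersetCard (N - 2),
              K1rhs (field ψ T) *
                ((∑ x ∈ Tᶜ, ((Tᶜ.card : ℝ) * field ψ T x / ∑ y, field ψ T y) ^ 3) / (Tᶜ.card : ℝ)) ≤
            K * ∑ T ∈ (Finset.univ : Finset (TorusSite 3 L)).powersetCard (N - 2), K1rhs (field ψ T)) →
      InsertionFieldDelocalisationAt (8 * K) := by
  intro K hK L _ hL N hN hNL ψ hψ hψ0 hH hnn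
  have hKT := hK L hL N hN hNL ψ hψ hψ0 hH hnn
  have hre : ∀ σ, 0 ≤ (ψ σ).re := fun σ => (hnn σ).1
  rw [K1Ineq, Finset.mul_sum]
  -- termwise `L³ K1lhs ≤ 4 K1rhs A₃ ≤ 8 K1rhs A₃`
  have hterm : ∀ T ∈ (Finset.univ : Finset (TorusSite 3 L)).powersetCard (N - 2),
      (L : ℝ) ^ 3 * K1lhs (field ψ T) ≤
        8 * (K1rhs (field ψ T) *
          ((∑ x ∈ Tᶜ, ((Tᶜ.card : ℝ) * field ψ T x / ∑ y, field ψ T y) ^ 3) / (Tᶜ.card : ℝ))) := by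
    intro T hT
    have hTcard : T.card = N - 2 := (Finset.mem_powersetCard.mp hT).2
    have hcc : Tᶜ.card = L ^ 3 - (N - 2) := by
      rw [Finset.card_compl, hTcard, card_torusSite]
    have hVn : L ^ 3 ≤ 2 * Tᶜ.card := by rw [hcc]; omega
    have hV : ((L : ℝ)) ^ 3 ≤ 2 * (Tᶜ.card : ℝ) := by exact_mod_cast hVn
    have h4 := mul_K1lhs_le_four_mul_thirdMoment (field ψ T) (field_nonneg ψ hre T) Tᶜ
      (fun x hx => field_eq_zero_of_mem ψ T (by simpa using hx)) ((L : ℝ) ^ 3) (by positivity) hV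
    -- the third-moment factor is nonnegative, so `4 ≤ 8` finishes
    have hA0 : 0 ≤ K1rhs (field ψ T) *
        ((∑ x ∈ Tᶜ, ((Tᶜ.card : ℝ) * field ψ T x / ∑ y, field ψ T y) ^ 3) / (Tᶜ.card : ℝ)) := by
      refine mul_nonneg (Finset.sum_nonneg fun i _ => by positivity) ?_
      refine div_nonneg (Finset.sum_nonneg fun x _ => pow_nonneg ?_ 3) (Nat.cast_nonneg _)
      exact div_nonneg (mul_nonneg (Nat.cast_nonneg _) (field_nonneg ψ hre T x))
        (Finset.sum_nonneg fun y _ => field_nonneg ψ hre T y)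
    linarith
  calc ∑ T ∈ (Finset.univ : Finset (TorusSite 3 L)).powersetCard (N - 2), (L : ℝ) ^ 3 * K1lhs (field ψ T)
      ≤ ∑ T ∈ (Finset.univ : Finset (TorusSite 3 L)).powersetCard (N - 2),
          8 * (K1rhs (field ψ T) *
            ((∑ x ∈ Tᶜ, ((Tᶜ.card : ℝ) * field ψ T x / ∑ y, field ψ T y) ^ 3) / (Tᶜ.card : ℝ))) :=
        Finset.sum_le_sum hterm
    _ = 8 * ∑ T ∈ (Finset.univ : Finset (TorusSite 3 L)).powersetCard (N - 2),
          K1rhs (field ψ T) *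
            ((∑ x ∈ Tᶜ, ((Tᶜ.card : ℝ) * field ψ T x / ∑ y, field ψ T y) ^ 3) / (Tᶜ.card : ℝ)) := by
        rw [← Finset.mul_sum]
    _ ≤ 8 * (K * ∑ T ∈ (Finset.univ : Finset (TorusSite 3 L)).powersetCard (N - 2), K1rhs (field ψ T)) :=
        mul_le_mul_of_nonneg_left hKT (by norm_num)
    _ = 8 * K * ∑ T ∈ (Finset.univ : Finset (TorusSite 3 L)).powersetCard (N - 2), K1rhs (field ψ T) := by
        ring


/-! ### S2 · Perron–Frobenius positivity -/


/-- **Zero propagation** for a nonnegative real eigenvector of the XY Hamiltonian: if `ψ σ = 0`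
and the Heisenberg exchange connects `σ` to `τ`, then `ψ τ = 0`. [folklore] -/
theorem eq_zero_of_exchange_ne_zero {d L : ℕ} [NeZero L] {E : ℂ}
    {ψ : TensorIndex (TorusSite d L) 2 → ℂ} (hH : (xyTorus d L 1).mulVec ψ = E • ψ)
    (hnn : ∀ σ, 0 ≤ (ψ σ).re ∧ (ψ σ).im = 0) {σ τ : TensorIndex (TorusSite d L) 2}
    (hσ : ψ σ = 0) (hστ : heisenbergHamiltonian 1 (torusGraph d L) 1 σ τ ≠ 0) : ψ τ = 0 := by
  by_cases heq : σ = τ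
  · exact heq ▸ hσ
  set H := xyTorus d L 1 with hHdef
  -- entries of `H = xxzHamiltonian 1 (torusGraph d L) (-1) 0`
  have hent : H σ τ ≠ 0 := by
    have h1 : H σ τ = heisenbergHamiltonian 1 (torusGraph d L) (-1) σ τ := by
      rw [hHdef]
      exact (xxzZero_apply (torusGraph d L) (-1) σ τ).trans (if_neg heq)
    have hscale : heisenbergHamiltonian 1 (torusGraph d L) (-1) σ τ =
        ((-1 : ℝ) : ℂ) * heisenbergHamiltonian 1 (torusGraph d L) 1 σ τ := by
      rw [LiebMattis.heisenbergHamiltonian_apply, LiebMattis.heisenbergHamiltonian_apply]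
      push_cast
      ring
    rw [h1, hscale]
    exact mul_ne_zero (by norm_num) hστ
  have hreal : ∀ τ', (H σ τ').im = 0 := fun τ' => by
    have h := star_xxzZero_apply (torusGraph d L) (-1) σ τ'
    exact Complex.conj_eq_iff_im.mp h
  have hre_ne : (H σ τ).re ≠ 0 := fun h0 => hent (Complex.ext h0 (hreal τ))
  -- row `σ` of the eigen-equation: `Σ_τ' H σ τ' ψ τ' = E ψ σ = 0`
  have hrow : ∑ τ', H σ τ' * ψ τ' = 0 := by
    have h := congrFun hH σ
    simp only [Matrix.mulVec, dotProduct, Pi.smul_apply, smul_eq_mul, hσ, mul_zero] at h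
    exact h
  have hterm : ∀ τ', (H σ τ' * ψ τ').re = (H σ τ').re * (ψ τ').re := fun τ' => by
    rw [Complex.mul_re, (hnn τ').2, mul_zero, sub_zero]
  have hnonpos : ∀ τ' ∈ (Finset.univ : Finset (TensorIndex (TorusSite d L) 2)),
      (H σ τ').re * (ψ τ').re ≤ 0 := by
    intro τ' _
    by_cases h' : σ = τ'
    · subst h'
      rw [hσ, Complex.zero_re, mul_zero]
    · exact mul_nonpos_of_nonpos_of_nonneg
        (re_xxzZero_apply_nonpos (torusGraph d L) (by norm_num) h') (hnn τ').1
  have hsum : ∑ τ', (H σ τ').re * (ψ τ').re = 0 := by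
    have h := congrArg Complex.re hrow
    rw [Complex.re_sum, Complex.zero_re] at h
    simpa only [hterm] using h
  have hτ0 : (H σ τ).re * (ψ τ).re = 0 :=
    (Finset.sum_eq_zero_iff_of_nonpos hnonpos).mp hsum τ (Finset.mem_univ τ)
  have hψre : (ψ τ).re = 0 := by
    rcases mul_eq_zero.mp hτ0 with h | h
    · exact absurd h hre_ne
    · exact h
  exact Complex.ext hψre (hnn τ).2

/-- **Stub S2 `stub_amplitudePos`** (statement verbatim from the skeleton
`Lines/log-insertion-infrared-bound.lean`): Perron–Frobenius positivity of nonnegative sector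
eigenvectors of the hard-core Bose gas on `(ℤ/Lℤ)³` on every `N`-set. [folklore] -/
theorem stub_amplitudePos_proof :
    ∀ (L : ℕ) [NeZero L], 2 ≤ L → ∀ N : ℕ, 2 ≤ N → 2 * N ≤ L ^ 3 →
      ∀ ψ : TensorIndex (TorusSite 3 L) 2 → ℂ,
        ψ ∈ spinZSector 1 ((N : ℝ) - (L : ℝ) ^ 3 / 2) → ψ ≠ 0 →
        (xyTorus 3 L 1).mulVec ψ =
          ((lowestEnergyInSector 1 (xyTorus 3 L 1) ((N : ℝ) - (L : ℝ) ^ 3 / 2) : ℝ) : ℂ) • ψ →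
        (∀ σ, 0 ≤ (ψ σ).re ∧ (ψ σ).im = 0) →
        ∀ S : Finset (TorusSite 3 L), S.card = N → 0 < (ψ (fun x => if x ∈ S then 0 else 1)).re := by
  intro L _ hL N hN hNL ψ hψ hψ0 hH hnn S hS
  by_contra hle
  push Not at hle
  have hzero : ψ (fun x => if x ∈ S then 0 else 1) = 0 :=
    Complex.ext (le_antisymm hle (hnn _).1) (hnn _).2
  -- a charged `N`-set exists
  have hMsec : (N : ℝ) - (L : ℝ) ^ 3 / 2 = (N : ℝ) - (Fintype.card (TorusSite 3 L) : ℝ) / 2 := by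
    rw [card_torusSite]
    push_cast
    ring
  obtain ⟨S', hS', hpos⟩ := exists_occSet_pos ψ N _ hMsec hψ hψ0 hnn
  -- the two indicators have the same weight `L³ - N`
  have hw : (∑ z, (((fun x => if x ∈ S then (0 : Fin 2) else 1) z : Fin 2) : ℕ)) =
      ∑ z, (((fun x => if x ∈ S' then (0 : Fin 2) else 1) z : Fin 2) : ℕ) := by
    rw [weight_ind S, weight_ind S', Finset.card_compl, Finset.card_compl, hS, hS']
  have hconn := LiebMattis.reflTransGen_of_weight_eq 1 (torusGraph 3 L) 1 (torusGraph_connected 3 L)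
    one_pos _ _ _ rfl hw
  -- propagate the zero along the chain
  have hprop : ∀ σ τ : TensorIndex (TorusSite 3 L) 2,
      Relation.ReflTransGen (fun a b => heisenbergHamiltonian 1 (torusGraph 3 L) 1 a b ≠ 0) σ τ →
      ψ σ = 0 → ψ τ = 0 := by
    intro σ τ h
    induction h with
    | refl => exact id
    | tail _ hbc ih => exact fun h0 => eq_zero_of_exchange_ne_zero hH hnn (ih h0) hbc
  have h0 := hprop _ _ hconn hzero
  rw [h0, Complex.zero_re] at hpos
  exact lt_irrefl 0 hpos


/-! ### S3 · AM–GM re-centring -/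


/-- **AM–GM re-centring (Jensen for `log`)**: for a positive field `r` on a nonempty finset `s`
(`n = #s`, `R = Σ_s r`, `ḡ = n⁻¹ Σ_s log r`) and `x ∈ s`, `(n r_x / R)³ ≤ exp 3(log r_x − ḡ)`,
because `ḡ ≤ log (R/n)`. [folklore] -/
theorem cube_le_exp_of_pos {ι : Type*} (s : Finset ι) (r : ι → ℝ) (hr : ∀ i ∈ s, 0 < r i)
    {x : ι} (hx : x ∈ s) :
    ((s.card : ℝ) * r x / ∑ y ∈ s, r y) ^ 3 ≤
      Real.exp (3 * (Real.log (r x) - (∑ y ∈ s, Real.log (r y)) / (s.card : ℝ))) := by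
  have hne : s.Nonempty := ⟨x, hx⟩
  have hn : (0 : ℝ) < s.card := by exact_mod_cast hne.card_pos
  have hR : 0 < ∑ y ∈ s, r y := Finset.sum_pos hr hne
  set gbar : ℝ := (∑ y ∈ s, Real.log (r y)) / (s.card : ℝ) with hgbar
  -- Jensen: gbar ≤ log (R / n)
  have hJ : gbar ≤ Real.log ((∑ y ∈ s, r y) / (s.card : ℝ)) := by
    have h := (strictConcaveOn_log_Ioi.concaveOn).le_map_sum (t := s) (w := fun _ => (s.card : ℝ)⁻¹)
      (p := r) (fun _ _ => inv_nonneg.mpr hn.le)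
      (by rw [Finset.sum_const, nsmul_eq_mul, mul_inv_cancel₀ hn.ne'])
      (fun i hi => Set.mem_Ioi.mpr (hr i hi))
    simp only [smul_eq_mul] at h
    rw [← Finset.mul_sum, ← Finset.mul_sum] at h
    calc gbar = (s.card : ℝ)⁻¹ * ∑ y ∈ s, Real.log (r y) := by rw [hgbar, div_eq_inv_mul]
      _ ≤ Real.log ((s.card : ℝ)⁻¹ * ∑ y ∈ s, r y) := h
      _ = Real.log ((∑ y ∈ s, r y) / (s.card : ℝ)) := by rw [div_eq_inv_mul]
  have hexp : Real.exp gbar ≤ (∑ y ∈ s, r y) / (s.card : ℝ) := by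
    have := Real.exp_le_exp.mpr hJ
    rwa [Real.exp_log (div_pos hR hn)] at this
  have hrx : 0 < r x := hr x hx
  -- n r_x / R = r_x / (R/n) ≤ r_x / exp gbar = exp (log r_x - gbar)
  have hstep : (s.card : ℝ) * r x / ∑ y ∈ s, r y ≤ Real.exp (Real.log (r x) - gbar) := by
    rw [Real.exp_sub, Real.exp_log hrx]
    have e : (s.card : ℝ) * r x / ∑ y ∈ s, r y = r x / ((∑ y ∈ s, r y) / (s.card : ℝ)) := by
      field_simp
    rw [e]
    exact div_le_div_of_nonneg_left hrx.le (Real.exp_pos _) hexp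
  have h0 : 0 ≤ (s.card : ℝ) * r x / ∑ y ∈ s, r y :=
    div_nonneg (mul_nonneg hn.le hrx.le) hR.le
  calc ((s.card : ℝ) * r x / ∑ y ∈ s, r y) ^ 3
      ≤ (Real.exp (Real.log (r x) - gbar)) ^ 3 := pow_le_pow_left₀ h0 hstep 3
    _ = Real.exp (3 * (Real.log (r x) - gbar)) := by
        rw [show (3 : ℝ) * (Real.log (r x) - gbar) = ((3 : ℕ) : ℝ) * (Real.log (r x) - gbar) by
          norm_num, Real.exp_nat_mul]

/-- The `ω`-weight is nonnegative. [folklore] -/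
theorem K1rhs_nonneg {ι : Type*} [Fintype ι] (r : ι → ℝ) : 0 ≤ K1rhs r :=
  Finset.sum_nonneg fun i _ => by positivity

/-- **Stub S3 `stub_logMeanDomination`** (statement verbatim from the skeleton
`Lines/log-insertion-infrared-bound.lean`): positivity + centred exponential moment of the
log-insertion field ⇒ arithmetic-mean normalised third moment, same constant. [folklore] -/
theorem stub_logMeanDomination_proof :
    ∀ K : ℝ,
      (∀ (L : ℕ) [NeZero L], 2 ≤ L → ∀ N : ℕ, 2 ≤ N → 2 * N ≤ L ^ 3 →
        ∀ ψ : TensorIndex (TorusSite 3 L) 2 → ℂ,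
          ψ ∈ spinZSector 1 ((N : ℝ) - (L : ℝ) ^ 3 / 2) → ψ ≠ 0 →
          (xyTorus 3 L 1).mulVec ψ =
            ((lowestEnergyInSector 1 (xyTorus 3 L 1) ((N : ℝ) - (L : ℝ) ^ 3 / 2) : ℝ) : ℂ) • ψ →
          (∀ σ, 0 ≤ (ψ σ).re ∧ (ψ σ).im = 0) →
          ∀ S : Finset (TorusSite 3 L), S.card = N → 0 < (ψ (fun x => if x ∈ S then 0 else 1)).re) →
      (∀ (L : ℕ) [NeZero L], 2 ≤ L → ∀ N : ℕ, 2 ≤ N → 2 * N ≤ L ^ 3 →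
        ∀ ψ : TensorIndex (TorusSite 3 L) 2 → ℂ,
          ψ ∈ spinZSector 1 ((N : ℝ) - (L : ℝ) ^ 3 / 2) → ψ ≠ 0 →
          (xyTorus 3 L 1).mulVec ψ =
            ((lowestEnergyInSector 1 (xyTorus 3 L 1) ((N : ℝ) - (L : ℝ) ^ 3 / 2) : ℝ) : ℂ) • ψ →
          (∀ σ, 0 ≤ (ψ σ).re ∧ (ψ σ).im = 0) →
          ∑ T ∈ (Finset.univ : Finset (TorusSite 3 L)).powersetCard (N - 2),
              K1rhs (field ψ T) *
                ((∑ x ∈ Tᶜ, Real.exp (3 * (Real.log (field ψ T x) -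
                    (∑ y ∈ Tᶜ, Real.log (field ψ T y)) / (Tᶜ.card : ℝ)))) / (Tᶜ.card : ℝ)) ≤
            K * ∑ T ∈ (Finset.univ : Finset (TorusSite 3 L)).powersetCard (N - 2), K1rhs (field ψ T)) →
      (∀ (L : ℕ) [NeZero L], 2 ≤ L → ∀ N : ℕ, 2 ≤ N → 2 * N ≤ L ^ 3 →
        ∀ ψ : TensorIndex (TorusSite 3 L) 2 → ℂ,
          ψ ∈ spinZSector 1 ((N : ℝ) - (L : ℝ) ^ 3 / 2) → ψ ≠ 0 →
          (xyTorus 3 L 1).mulVec ψ =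
            ((lowestEnergyInSector 1 (xyTorus 3 L 1) ((N : ℝ) - (L : ℝ) ^ 3 / 2) : ℝ) : ℂ) • ψ →
          (∀ σ, 0 ≤ (ψ σ).re ∧ (ψ σ).im = 0) →
          ∑ T ∈ (Finset.univ : Finset (TorusSite 3 L)).powersetCard (N - 2),
              K1rhs (field ψ T) *
                ((∑ x ∈ Tᶜ, ((Tᶜ.card : ℝ) * field ψ T x / ∑ y, field ψ T y) ^ 3) / (Tᶜ.card : ℝ)) ≤
            K * ∑ T ∈ (Finset.univ : Finset (TorusSite 3 L)).powersetCard (N - 2), K1rhs (field ψ T)) := by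
  intro K hpos hlog L _ hL N hN hNL ψ hψ hψ0 hH hnn
  refine le_trans (Finset.sum_le_sum fun T hT => ?_) (hlog L hL N hN hNL ψ hψ hψ0 hH hnn)
  have hTcard : T.card = N - 2 := (Finset.mem_powersetCard.mp hT).2
  have hre : ∀ σ, 0 ≤ (ψ σ).re := fun σ => (hnn σ).1
  -- the free set has at least two sites
  have hcc : Tᶜ.card = L ^ 3 - (N - 2) := by
    rw [Finset.card_compl, hTcard, card_torusSite]
  have htwo : 1 < Tᶜ.card := by rw [hcc]; omega
  -- positivity of the insertion field on the free sites
  have hposT : ∀ x ∈ Tᶜ, 0 < field ψ T x := by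
    intro x hx
    have hxT : x ∉ T := Finset.mem_compl.mp hx
    obtain ⟨y, hy, hyx⟩ := Finset.exists_mem_ne htwo x
    have hyT : y ∉ T := Finset.mem_compl.mp hy
    have hcard : (insert x (insert y T)).card = N := by
      rw [Finset.card_insert_of_notMem, Finset.card_insert_of_notMem hyT, hTcard]
      · omega
      · simp only [Finset.mem_insert, not_or]
        exact ⟨fun h => hyx h.symm, hxT⟩
    exact lt_of_lt_of_le (hpos L hL N hN hNL ψ hψ hψ0 hH hnn _ hcard)
      (le_field ψ hre T hxT hyT (fun h => hyx h.symm))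
  -- the total equals the free-site sum
  have hR : ∑ y, field ψ T y = ∑ y ∈ Tᶜ, field ψ T y := by
    symm
    refine Finset.sum_subset (Finset.subset_univ _) fun y _ hy => ?_
    exact field_eq_zero_of_mem ψ T (by simpa using hy)
  refine mul_le_mul_of_nonneg_left ?_ (K1rhs_nonneg _)
  refine div_le_div_of_nonneg_right ?_ (Nat.cast_nonneg _)
  rw [hR]
  exact Finset.sum_le_sum fun x hx => cube_le_exp_of_pos Tᶜ (field ψ T) hposT hx


/-! ### The composition: S4 alone implies the crux -/

/-- **`InsertionFieldDelocalisation` follows from the single open stub S4** (`LogInsertionExpMoment`,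
body verbatim from the skeleton), with constant `M = 8K`: S4 ⟹(S3, using S2) normalised third
moment ⟹(S1) the crux at `8K`. [folklore] -/
theorem insertionFieldDelocalisation_of_logInsertionExpMoment
    (h₄ : ∃ K : ℝ,
      ∀ (L : ℕ) [NeZero L], 2 ≤ L → ∀ N : ℕ, 2 ≤ N → 2 * N ≤ L ^ 3 →
        ∀ ψ : TensorIndex (TorusSite 3 L) 2 → ℂ,
          ψ ∈ spinZSector 1 ((N : ℝ) - (L : ℝ) ^ 3 / 2) → ψ ≠ 0 →
          (xyTorus 3 L 1).mulVec ψ =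
            ((lowestEnergyInSector 1 (xyTorus 3 L 1) ((N : ℝ) - (L : ℝ) ^ 3 / 2) : ℝ) : ℂ) • ψ →
          (∀ σ, 0 ≤ (ψ σ).re ∧ (ψ σ).im = 0) →
          ∑ T ∈ (Finset.univ : Finset (TorusSite 3 L)).powersetCard (N - 2),
              K1rhs (field ψ T) *
                ((∑ x ∈ Tᶜ, Real.exp (3 * (Real.log (field ψ T x) -
                    (∑ y ∈ Tᶜ, Real.log (field ψ T y)) / (Tᶜ.card : ℝ)))) / (Tᶜ.card : ℝ)) ≤
            K * ∑ T ∈ (Finset.univ : Finset (TorusSite 3 L)).powersetCard (N - 2), K1rhs (field ψ T)) :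
    Summit.AtomisticToContinuum.BoseEinsteinCondensation.Theses.BECStronglyRayleigh.InsertionFieldDelocalisation := by
  obtain ⟨K, hK⟩ := h₄
  exact insertionFieldDelocalisation_iff.mpr
    ⟨8 * K, stub_thirdMomentReduction_proof K (stub_logMeanDomination_proof K stub_amplitudePos_proof hK)⟩

end Summit.AtomisticToContinuum.BoseEinsteinCondensation.Cruxes.InsertionFieldDelocalisation.LogInsertionInfraredBound.Drefute

end
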